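import Literature.AlgebraicGeometry.Resolution.NearPointsPointCentreLineGlobal
import HarnessLib

/-!
# The closure of a non-closed near point over a `τ = 1` point centre is a regular curve (CoP1, Lemma 4.3 (5), Prop. 4.4 (*))

Topic: `Literature/AlgebraicGeometry/Resolution`. [CoP1] = Cossart–Piltant, J. Algebra 320 (2008) 1051–1082, Lemma 4.3 (1), (3), (5),
p. 8, and (*) of the proof of Prop. 4.4, pp. 10–11: «each exceptional curve in `Σ(i+1)` created by the algorithm is regular». Consequences
of the core theorem `IsBlowup.stalkIdeal_vanishingIdeal_closure_eq_span_lineGerm` (`NearPointsPointCentreLineGlobal.lean`: at every point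
of the closure of a non-closed near point `η′` over a `τ = 1` point, the ideal of the closure IS the line germ `(g_j, g_{j₀}/g_j)`), in the
form consumed by the REACH step of Prop. 4.4 (census row ρ1 `pointStep_curves` of the res-hironaka inputs cell). PROVED, no definitions,
no named facts:

* `IsBlowup.stalkTau_eq_one_of_isNear_of_not_isClosed` — a non-closed near point over a closed threefold point forces `τ(x) = 1`
  (`τ = 3`: no near point, Lemma 4.3 (1); `τ = 2`: the near point is closed, Lemma 4.3 (3));
* `IsBlowup.exists_isRsopPart_span_eq_stalkIdeal_closure_of_isNear` — the ideal of `cl{η′}` at each of its points is generated by a pair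
  that is part of a regular system of parameters;
* `IsBlowup.isRegular_subscheme_closure_of_isNear_of_not_isClosed` — **`cl{η′}` with its reduced structure is regular, cut out by rsop
  pairs**;
* `IsBlowup.eq_or_disjoint_closure_of_isNear_of_not_isClosed` — two non-closed near points over `x` are EQUAL or have DISJOINT closures.
  (Full uniqueness — `L_x ≅ ℙ¹` — needs the exceptional fibre as `ℙ²` and is not proved here.)

AI-written; weaker than expert review.

## Sources

* V. Cossart, O. Piltant, J. Algebra 320 (2008) 1051–1082, Lemma 4.3 (1), (3), (5) and proof of Prop. 4.4 (*), pp. 8–11. [CossartPiltant2008]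
-/

noncomputable section

open CategoryTheory AlgebraicGeometry TopologicalSpace IsLocalRing

namespace Literature.AlgebraicGeometry.Resolution

universe u

open Scheme.IdealSheafData

variable {X X' : Scheme.{u}} {π : X' ⟶ X}

/-- Points over a closed point centre: a specialisation of a point over `x` lies over `x`. [folklore] -/
private theorem apply_eq_of_specializes_of_apply_eq {x : X} (hx : IsClosed ({x} : Set X)) {η' y : X'} (h : η' ⤳ y) (hη : π η' = x) :
    π y = x := by
  have h' : π η' ⤳ π y := h.map π.continuous
  rw [hη] at h'
  exact h'.mem_closed hx (Set.mem_singleton x)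

/-- **A non-closed near point over a closed threefold point forces `τ(x) = 1`** ([CoP1] Lemma 4.3 (1): no near point when
`τ(x) = 3`; (3): for `τ(x) = 2` the near point is unique, hence a closed point). [cite: CossartPiltant2008, Lemma 4.3 (1) (3)] -/
theorem IsBlowup.stalkTau_eq_one_of_isNear_of_not_isClosed [IsLocallyNoetherian X] [IsLocallyNoetherian X']
    (hX : Scheme.IsRegular X) {x : X} (hx : IsClosed ({x} : Set X)) (hπ : IsBlowup π (vanishingIdeal ⟨{x}, hx⟩))
    {J : X.IdealSheafData} {μ : ℕ} (hμ : 1 ≤ μ) (hord : idealOrder J x = μ)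
    (hdim : (maximalIdeal (X.presheaf.stalk x)).spanFinrank = 3) {η' : X'} (hη : π η' = x)
    (hnear : IsNear π (vanishingIdeal ⟨{x}, hx⟩) J μ η') (hηcl : ¬ IsClosed ({η'} : Set X')) :
    haveI := hX x; stalkTau J x μ = 1 := by
  subst hη
  haveI : IsRegularLocalRing (X.presheaf.stalk (π η')) := hX (π η')
  have hX' : Scheme.IsRegular X' := hπ.isRegular_of_isRegular_subscheme hX (isRegular_subscheme_vanishingIdeal_singleton hx)
  have h1 : 1 ≤ stalkTau J (π η') μ := one_le_stalkTau J (π η') hμ hord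
  have h3 : stalkTau J (π η') μ ≤ 3 := hdim ▸ stalkTau_le J (π η') μ
  obtain ⟨c₀, hc₀⟩ := exists_regularSystemOfParameters (R := X.presheaf.stalk (π η'))
  let c : Fin 3 → X.presheaf.stalk (π η') := c₀ ∘ finCongr hdim.symm
  have hc : Ideal.span (Set.range c) = maximalIdeal _ := by
    rw [Set.range_comp, (finCongr hdim.symm).surjective.range_eq, Set.image_univ, hc₀]
  have hcY : Ideal.span (Set.range c) = stalkIdeal (vanishingIdeal ⟨{π η'}, hx⟩) (π η') := by
    rw [hc, stalkIdeal_vanishingIdeal_singleton hx]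
  have hY : ∀ y ∈ ((⟨{π η'}, hx⟩ : Closeds X) : Set X), idealOrder J y = μ := by
    rintro y (rfl : y = π η'); exact hord
  by_contra hne
  rcases (show stalkTau J (π η') μ = 2 ∨ stalkTau J (π η') μ = 3 by omega) with h2 | h3'
  · exact hηcl (hπ.isClosed_singleton_of_isNear_point hX hX' (isRegular_subscheme_vanishingIdeal_singleton hx) hY hx
      hdim hc hcY h2 hnear)
  · exact hπ.not_isNear_of_stalkTau_eq_three hdim hc hcY h3' hnear

section Line

variable [IsLocallyNoetherian X] [IsLocallyNoetherian X'] (hX : Scheme.IsRegular X)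
  {x : X} (hx : IsClosed ({x} : Set X))
  (hπ : IsBlowup π (vanishingIdeal ⟨{x}, hx⟩)) {J : X.IdealSheafData} {μ : ℕ}
  (hord : idealOrder J x = μ) (hdim : (maximalIdeal (X.presheaf.stalk x)).spanFinrank = 3)
  (hτ : haveI := hX x; stalkTau J x μ = 1)
  {η' : X'} (hη : π η' = x) (hnear : IsNear π (vanishingIdeal ⟨{x}, hx⟩) J μ η') (hηcl : ¬ IsClosed ({η'} : Set X'))

include hX hπ hord hdim hτ hη hnear hηcl

/-- **The ideal of the line `L = cl{η′}` at each of its points is the line germ** `(g_j, g_{j₀}/g_j)`: for a non-closed near point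
`η′` over the closed `τ = 1` point `x`, at every `y ∈ cl{η′}` the ideal `𝓘_{L,y}` is generated by a pair that is part of a regular system
of parameters of `𝒪_{X′,y}`. [cite: CossartPiltant2008, Lemma 4.3 (5); Prop. 4.4 (proof, (*))] -/
theorem IsBlowup.exists_isRsopPart_span_eq_stalkIdeal_closure_of_isNear (y : X') (hy : y ∈ closure ({η'} : Set X')) :
    ∃ c : Fin 2 → X'.presheaf.stalk y, IsRsopPart c ∧
      Ideal.span (Set.range c) = stalkIdeal (vanishingIdeal (⟨closure {η'}, isClosed_closure⟩ : Closeds X')) y := by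
  classical
  haveI hRx : IsRegularLocalRing (X.presheaf.stalk x) := hX x
  have hX' : Scheme.IsRegular X' := hπ.isRegular_of_isRegular_subscheme hX (isRegular_subscheme_vanishingIdeal_singleton hx)
  obtain ⟨U, hxU, g, hcg, j₀, hadg⟩ := exists_adapted_sections hX hdim hτ
  have hsp : η' ⤳ y := specializes_iff_mem_closure.mpr hy
  have hyx : π y = x := apply_eq_of_specializes_of_apply_eq hx hsp hη
  have hnear_y : IsNear π (vanishingIdeal ⟨{x}, hx⟩) J μ y := hπ.isNear_of_specializes_of_isNear_point hX hX' hx hord hnear hη hsp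
  obtain ⟨j, hyU, w, -, hmap_y, hrel_y, hrsop_y⟩ :=
    hπ.exists_line_germ_of_isNear_of_sections hx hdim hxU g hcg j₀ hτ hadg hyx hnear_y
  exact ⟨_, hrsop_y, (hπ.stalkIdeal_vanishingIdeal_closure_eq_span_lineGerm hX hx hord hdim hτ hxU g hcg j₀ hadg hyx hyU
    hmap_y hrel_y hrsop_y hη hnear hηcl hsp).symm⟩

/-- **The closure of a non-closed near point over a `τ = 1` point centre is a regular curve cut out by rsop pairs** ([CoP1] (*) of the
proof of Prop. 4.4: «each exceptional curve … created by the algorithm is regular»). [cite: CossartPiltant2008, Prop. 4.4 (proof, (*)); Lemma 4.3 (5)] -/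
theorem IsBlowup.isRegular_subscheme_closure_of_isNear_of_not_isClosed :
    Scheme.IsRegular (vanishingIdeal (⟨closure {η'}, isClosed_closure⟩ : Closeds X')).subscheme ∧
      ∀ y ∈ closure ({η'} : Set X'), ∀ hr : IsRegularLocalRing (X'.presheaf.stalk y),
        ∃ c : Fin 2 → X'.presheaf.stalk y, @IsRsopPart _ _ _ 2 c ∧
          Ideal.span (Set.range c) = stalkIdeal (vanishingIdeal (⟨closure {η'}, isClosed_closure⟩ : Closeds X')) y := by
  refine ⟨Scheme.isRegular_subscheme_of_forall _ fun y hy => ?_, fun y hy _ =>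
    IsBlowup.exists_isRsopPart_span_eq_stalkIdeal_closure_of_isNear hX hx hπ hord hdim hτ hη hnear hηcl y hy⟩
  have hy' : y ∈ closure ({η'} : Set X') := by
    rwa [← SetLike.mem_coe, coe_support_vanishingIdeal] at hy
  obtain ⟨c, hc, hspan⟩ :=
    IsBlowup.exists_isRsopPart_span_eq_stalkIdeal_closure_of_isNear hX hx hπ hord hdim hτ hη hnear hηcl y hy'
  rw [← hspan]
  exact hc.isRegularLocalRing_quotient

/-- **Two non-closed near points over the same `τ = 1` point are equal or have disjoint closures**: at a common point `y` both ideals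
`𝓘_{cl η′,y}`, `𝓘_{cl η″,y}` are the line germ, so the primes of `η′`, `η″` in `𝒪_{X′,y}` coincide. (Full uniqueness — the line
`L_x ≅ ℙ¹` has one non-closed point — needs the exceptional fibre as `ℙ²`, not used here.) [cite: CossartPiltant2008, Lemma 4.3 (5)] -/
theorem IsBlowup.eq_or_disjoint_closure_of_isNear_of_not_isClosed {η'' : X'} (hη'' : π η'' = x)
    (hnear'' : IsNear π (vanishingIdeal ⟨{x}, hx⟩) J μ η'') (hηcl'' : ¬ IsClosed ({η''} : Set X')) :
    η'' = η' ∨ Disjoint (closure ({η'} : Set X')) (closure {η''}) := by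
  classical
  by_cases hdisj : Disjoint (closure ({η'} : Set X')) (closure {η''})
  · exact Or.inr hdisj
  left
  obtain ⟨y, hy', hy''⟩ := Set.not_disjoint_iff.mp hdisj
  haveI hRx : IsRegularLocalRing (X.presheaf.stalk x) := hX x
  have hX' : Scheme.IsRegular X' := hπ.isRegular_of_isRegular_subscheme hX (isRegular_subscheme_vanishingIdeal_singleton hx)
  obtain ⟨U, hxU, g, hcg, j₀, hadg⟩ := exists_adapted_sections hX hdim hτ
  have hsp' : η' ⤳ y := specializes_iff_mem_closure.mpr hy'
  have hsp'' : η'' ⤳ y := specializes_iff_mem_closure.mpr hy''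
  have hyx : π y = x := apply_eq_of_specializes_of_apply_eq hx hsp' hη
  have hnear_y : IsNear π (vanishingIdeal ⟨{x}, hx⟩) J μ y := hπ.isNear_of_specializes_of_isNear_point hX hX' hx hord hnear hη hsp'
  obtain ⟨j, hyU, w, -, hmap_y, hrel_y, hrsop_y⟩ :=
    hπ.exists_line_germ_of_isNear_of_sections hx hdim hxU g hcg j₀ hτ hadg hyx hnear_y
  have h' := hπ.stalkIdeal_vanishingIdeal_closure_eq_span_lineGerm hX hx hord hdim hτ hxU g hcg j₀ hadg hyx hyU
    hmap_y hrel_y hrsop_y hη hnear hηcl hsp'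
  have h'' := hπ.stalkIdeal_vanishingIdeal_closure_eq_span_lineGerm hX hx hord hdim hτ hxU g hcg j₀ hadg hyx hyU
    hmap_y hrel_y hrsop_y hη'' hnear'' hηcl'' hsp''
  rw [stalkIdeal_vanishingIdeal_closure hsp'] at h'
  rw [stalkIdeal_vanishingIdeal_closure hsp''] at h''
  have hpt : (⟨primeOfSpecializes hsp'', inferInstance⟩ : PrimeSpectrum (X'.presheaf.stalk y)) =
      ⟨primeOfSpecializes hsp', inferInstance⟩ := PrimeSpectrum.ext (h''.trans h'.symm)
  have h1 : X'.fromSpecStalk y ⟨primeOfSpecializes hsp', inferInstance⟩ = η' :=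
    Literature.AlgebraicGeometry.Motives.fromSpecStalk_comap_maximalIdeal hsp'
  have h2 : X'.fromSpecStalk y ⟨primeOfSpecializes hsp'', inferInstance⟩ = η'' :=
    Literature.AlgebraicGeometry.Motives.fromSpecStalk_comap_maximalIdeal hsp''
  rw [hpt] at h2
  exact h2.symm.trans h1

end Line

end Literature.AlgebraicGeometry.Resolution

end
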